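import Literature.NumberTheory.Sieve.HeathBrownCubicLemma44
import Literature.NumberTheory.Sieve.HeathBrownCubicLatticeCount
import HarnessLib

/-!
# Heath-Brown's Lemma 4.5: `∑_{β̂ ∈ 𝒞} τ(β)² ≪ S₀³ (log S₀)^{c(A)}` for a cube `𝒞` of side `S₀`

Pure-proof file (no definitions, no named facts) in the decomposition of **Heath-Brown's Type II
estimate, Lemma 3.10** (`HeathBrown2001_lemma_3_10` of `HeathBrownCubicTypeII`), D. R. Heath-Brown,
*Primes represented by `x³ + 2y³`*, Acta Math. 186 (2001), 1–84.  **Lemma 4.5** (p. 23): "Let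
`𝒞 = (a₁, a₁ + S₀] × (a₂, a₂ + S₀] × (a₃, a₃ + S₀]` be a cube of side `S₀`, and suppose that
`max |a_i| ≤ S₀^A` for some positive constant `A`. For any `β = x + y·2^{1/3} + z·4^{1/3} ∈ K` write
`β̂ = (x, y, z)`. Then there is a constant `c(A)` such that `∑_{β̂ ∈ 𝒞} τ(β)² ≪ S₀³ (log S₀)^{c(A)}`."
Printed proof: Lemma 4.4 with `n > 3A` gives `τ(β)² ≤ max{τ(I)^{c(A)} : I ∣ β, N(I) ≪ S₀} ≤ ∑_{I∣β, N(I)≪S₀} τ(I)^{c(A)}`,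
so `∑_{β̂ ∈ 𝒞} τ(β)² ≪ ∑_{N(I) ≪ S₀} τ(I)^{c(A)} S₀³ N(I)⁻¹ ≪ S₀³ (log S₀)^{c(A)}` by Lemma 4.2, using "if `𝒞'`
is a cube of side `N(I)`, then there are `O(N(I)²)` values of `β ∈ 𝒞'` for which `I ∣ β`".

This file PROVES the lemma (`HeathBrown2001_lemma_4_5`) for the tree's objects: `latticeCube a S₀`
(the integer vectors of the cube), `coordElt` (`β̂ ↦ β`), `idealDivisorCount` (`τ`, applied to the
principal ideal `(β)`), with `A` a positive integer (any real `A > 0` is covered by `⌈A⌉`) and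
`c(A) = 2^{48A+208} + 1`:

* `norm_embedding_θ_le` (`|σ(2^{1/3})| ≤ 2` for every embedding `σ : K → ℂ`),
  **`absNorm_span_coordElt_le`** (`N((β)) ≤ 64 (|x| + |y| + |z|)³`, from `N = ∏_σ σ(β)`);
* `idealDivisorCount_top`, **`exists_sum_idealDivisorCount_pow_div_le`** — the harmonic form of
  Lemma 4.2 over `K`: `∑_{0 < N(I) ≤ N} τ(I)^c/N(I) ≤ C (log N)^{2^{4c+4}+1}` (`N ≥ 2`), by dyadic halving
  from the tree's `exists_sum_idealDivisorCount_pow_le`;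
* **`HeathBrown2001_lemma_4_5`**.

## References

* D. R. Heath-Brown, *Primes represented by `x³ + 2y³`*, Acta Math. 186 (2001), 1–84: Lemma 4.5 and
  its proof, p. 23. [cite: HeathBrownActa2001, Lemma 4.5]

## Mathlib / tree search

Mathlib: `Ideal.absNorm_span_singleton`, `Algebra.coe_norm_int`, `Algebra.norm_eq_prod_embeddings`,
`AlgHom.card`, `Complex.norm_ratCast`, `Ideal.dvd_span_singleton`, `Nat.log`; nothing on divisor sums
over number fields. Tree: `HeathBrownCubicLemma44` (`HeathBrown2001_lemma_4_4`),
`HeathBrownCubicLatticeCount` (`card_latticeCube_filter_mem_le'`, `coordElt_injective`),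
`HeathBrownCubicSieveSetupProofs` (`exists_sum_idealDivisorCount_pow_le` = Lemma 4.2 over `K`),
`HeathBrownCubicTypeITools` (`idealDivisorCount_le_of_dvd`, `one_le_idealDivisorCount`),
`CubeRootTwoField` (`θ_pow_three`, `finrank_K`, `coe_θint`).
-/

noncomputable section

open Polynomial NumberField Finset

namespace Literature.NumberTheory.Sieve.CubicSieve

open LFunctions.CubeRootTwoField CubicPrimes

/-! ### The norm of `β = x + yθ + zθ²` -/

/-- Every complex embedding sends `θ = 2^{1/3}` to a cube root of `2`, of modulus `2^{1/3} ≤ 2`. [folklore] -/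
theorem norm_embedding_θ_le (σ : K →ₐ[ℚ] ℂ) : ‖σ θ‖ ≤ 2 := by
  have h3 : ‖σ θ‖ ^ 3 = 2 := by
    rw [← norm_pow, ← map_pow, θ_pow_three, map_ofNat, Complex.norm_ofNat]
  by_contra h
  push Not at h
  have : (2 : ℝ) ^ 3 < ‖σ θ‖ ^ 3 := pow_lt_pow_left₀ h (by norm_num) (by norm_num)
  rw [h3] at this
  norm_num at this

/-- `|σ(β)| ≤ 4(|x| + |y| + |z|)` for `β = x + yθ + zθ²` and every complex embedding `σ`. [folklore] -/
theorem norm_embedding_coordElt_le (σ : K →ₐ[ℚ] ℂ) (v : ℤ × ℤ × ℤ) :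
    ‖σ ((coordElt v : 𝓞 K) : K)‖ ≤ 4 * (|(v.1 : ℝ)| + |(v.2.1 : ℝ)| + |(v.2.2 : ℝ)|) := by
  have hθ := norm_embedding_θ_le σ
  have hθ0 : 0 ≤ ‖σ θ‖ := norm_nonneg _
  have hcoe : ((coordElt v : 𝓞 K) : K) = (v.1 : K) + (v.2.1 : K) * θ + (v.2.2 : K) * θ ^ 2 := by
    simp [coordElt, coe_θint]
  rw [hcoe, map_add, map_add, map_mul, map_mul, map_pow, map_intCast, map_intCast, map_intCast]
  have h1 : ‖(v.1 : ℂ)‖ = |(v.1 : ℝ)| := Complex.norm_intCast _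
  have h2 : ‖(v.2.1 : ℂ) * σ θ‖ ≤ |(v.2.1 : ℝ)| * 2 := by
    rw [norm_mul, Complex.norm_intCast]; gcongr
  have h3 : ‖(v.2.2 : ℂ) * σ θ ^ 2‖ ≤ |(v.2.2 : ℝ)| * 4 := by
    rw [norm_mul, Complex.norm_intCast, norm_pow]
    refine mul_le_mul_of_nonneg_left ?_ (abs_nonneg _)
    nlinarith
  calc ‖(v.1 : ℂ) + (v.2.1 : ℂ) * σ θ + (v.2.2 : ℂ) * σ θ ^ 2‖
      ≤ ‖(v.1 : ℂ) + (v.2.1 : ℂ) * σ θ‖ + ‖(v.2.2 : ℂ) * σ θ ^ 2‖ := norm_add_le _ _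
    _ ≤ (‖(v.1 : ℂ)‖ + ‖(v.2.1 : ℂ) * σ θ‖) + ‖(v.2.2 : ℂ) * σ θ ^ 2‖ := by
        gcongr; exact norm_add_le _ _
    _ ≤ (|(v.1 : ℝ)| + |(v.2.1 : ℝ)| * 2) + |(v.2.2 : ℝ)| * 4 := by rw [h1]; gcongr
    _ ≤ 4 * (|(v.1 : ℝ)| + |(v.2.1 : ℝ)| + |(v.2.2 : ℝ)|) := by
        have := abs_nonneg (v.1 : ℝ); have := abs_nonneg (v.2.1 : ℝ); linarith

/-- **`N((β)) ≤ 64 (|x| + |y| + |z|)³`** for `β = x + yθ + zθ²`: `N(β) = ∏_σ σ(β)` over the three complex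
embeddings. [folklore] -/
theorem absNorm_span_coordElt_le (v : ℤ × ℤ × ℤ) :
    (Ideal.absNorm (Ideal.span {coordElt v}) : ℝ) ≤
      64 * (|(v.1 : ℝ)| + |(v.2.1 : ℝ)| + |(v.2.2 : ℝ)|) ^ 3 := by
  set β : 𝓞 K := coordElt v with hβ
  set s : ℝ := |(v.1 : ℝ)| + |(v.2.1 : ℝ)| + |(v.2.2 : ℝ)| with hs
  have hs0 : 0 ≤ s := by positivity
  -- `N((β)) = |Norm_ℤ β| = |Norm_ℚ β| = ‖∏_σ σ β‖`
  have h1 : (Ideal.absNorm (Ideal.span {β}) : ℝ) = |((Algebra.norm ℤ β : ℤ) : ℝ)| := by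
    rw [Ideal.absNorm_span_singleton, Nat.cast_natAbs, Int.cast_abs]
  have h2 : ((Algebra.norm ℤ β : ℤ) : ℝ) = ((Algebra.norm ℚ (β : K) : ℚ) : ℝ) := by
    rw [← Algebra.coe_norm_int]; push_cast; rfl
  have h3 : ‖(algebraMap ℚ ℂ) (Algebra.norm ℚ (β : K))‖ = |((Algebra.norm ℚ (β : K) : ℚ) : ℝ)| := by
    rw [show (algebraMap ℚ ℂ) (Algebra.norm ℚ (β : K)) = ((Algebra.norm ℚ (β : K) : ℚ) : ℂ) from rfl,
      Complex.norm_ratCast]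
  have h4 : (algebraMap ℚ ℂ) (Algebra.norm ℚ (β : K)) = ∏ σ : K →ₐ[ℚ] ℂ, σ (β : K) :=
    Algebra.norm_eq_prod_embeddings ℚ ℂ (β : K)
  have hcard : Fintype.card (K →ₐ[ℚ] ℂ) = 3 := by rw [AlgHom.card, finrank_K]
  calc (Ideal.absNorm (Ideal.span {β}) : ℝ) = |((Algebra.norm ℚ (β : K) : ℚ) : ℝ)| := by rw [h1, h2]
    _ = ‖∏ σ : K →ₐ[ℚ] ℂ, σ (β : K)‖ := by rw [← h3, h4]
    _ = ∏ σ : K →ₐ[ℚ] ℂ, ‖σ (β : K)‖ := norm_prod _ _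
    _ ≤ ∏ _σ : K →ₐ[ℚ] ℂ, (4 * s) :=
        prod_le_prod (fun σ _ => norm_nonneg _) fun σ _ => norm_embedding_coordElt_le σ v
    _ = (4 * s) ^ 3 := by rw [prod_const, card_univ, hcard]
    _ = 64 * s ^ 3 := by ring

/-! ### The harmonic form of Lemma 4.2 over `K` -/

/-- `τ(1) = 1`. [folklore] -/
theorem idealDivisorCount_top : idealDivisorCount (⊤ : Ideal (𝓞 K)) = 1 := by
  classical
  unfold idealDivisorCount
  rw [card_eq_one]
  refine ⟨⊤, ?_⟩
  ext D
  simp only [mem_filter, mem_idealsLE, mem_singleton, Ideal.absNorm_top]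
  constructor
  · rintro ⟨-, hD⟩
    exact Ideal.isUnit_iff.mp (isUnit_of_dvd_one (by rwa [Ideal.one_eq_top]))
  · rintro rfl
    exact ⟨by rw [Ideal.absNorm_top], dvd_rfl⟩

open scoped Classical in
/-- The top dyadic block: `∑_{N/2 < N(I) ≤ N} τ(I)^c/N(I) ≤ (2/N) ∑_{0 < N(I) ≤ N} τ(I)^c`. [folklore] -/
theorem sum_top_block_le (c : ℕ) {N : ℕ} (hN : 0 < N) :
    ∑ I ∈ ((idealsLE N).filter (· ≠ ⊥)).filter (fun I => N / 2 < Ideal.absNorm I),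
        (idealDivisorCount I : ℝ) ^ c / Ideal.absNorm I ≤
      2 / N * ∑ I ∈ (idealsLE N).filter (· ≠ ⊥), (idealDivisorCount I : ℝ) ^ c := by
  have hN' : (0 : ℝ) < N := by exact_mod_cast hN
  rw [mul_sum]
  refine (sum_le_sum fun I hI => ?_).trans
    (sum_le_sum_of_subset_of_nonneg (filter_subset _ _) fun I _ _ => by positivity)
  rw [mem_filter] at hI
  have hgt : N / 2 < Ideal.absNorm I := hI.2
  have h2 : (N : ℝ) < 2 * (Ideal.absNorm I : ℝ) := by
    have : N < 2 * Ideal.absNorm I := by omega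
    exact_mod_cast this
  have hpos : (0 : ℝ) < Ideal.absNorm I := by
    have : 0 < Ideal.absNorm I := by omega
    exact_mod_cast this
  have h0 : 0 ≤ (idealDivisorCount I : ℝ) ^ c := by positivity
  rw [div_le_iff₀ hpos,
    show 2 / (N : ℝ) * (idealDivisorCount I : ℝ) ^ c * (Ideal.absNorm I : ℝ) =
      (idealDivisorCount I : ℝ) ^ c * (2 * (Ideal.absNorm I : ℝ) / N) by ring]
  refine le_mul_of_one_le_right h0 ?_
  rw [le_div_iff₀ hN', one_mul]
  exact h2.le

open scoped Classical in
/-- **Lemma 4.2 over `K`, harmonic form**: for every `c` there is `C` with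
`∑_{0 < N(I) ≤ N} τ(I)^c/N(I) ≤ C (log N)^{2^{4c+4}+1}` for all `N ≥ 2` (dyadic halving of the range and
the tree's moment bound `∑_{0<N(I)≤N} τ(I)^c ≤ C₀ N (log N)^{2^{4c+4}}`). [cite: HeathBrownActa2001, Lemma 4.2] -/
theorem exists_sum_idealDivisorCount_pow_div_le (c : ℕ) :
    ∃ C : ℝ, 0 < C ∧ ∀ N : ℕ, 2 ≤ N →
      ∑ I ∈ (idealsLE N).filter (· ≠ ⊥), (idealDivisorCount I : ℝ) ^ c / Ideal.absNorm I ≤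
        C * Real.log N ^ (2 ^ (4 * c + 4) + 1) := by
  obtain ⟨C₀, hC₀, h42⟩ := exists_sum_idealDivisorCount_pow_le c
  set e : ℕ := 2 ^ (4 * c + 4) with he
  -- `S(N) ≤ 1 + (log₂ N + 1) · 2C₀ (log N)^e` by strong induction (halving)
  set S : ℕ → ℝ := fun N =>
    ∑ I ∈ (idealsLE N).filter (· ≠ ⊥), (idealDivisorCount I : ℝ) ^ c / Ideal.absNorm I with hS
  have hSsplit : ∀ N : ℕ, 0 < N →
      S N = S (N / 2) + ∑ I ∈ ((idealsLE N).filter (· ≠ ⊥)).filter (fun I => N / 2 < Ideal.absNorm I),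
        (idealDivisorCount I : ℝ) ^ c / Ideal.absNorm I := by
    intro N hN
    simp only [hS]
    rw [← sum_filter_add_sum_filter_not ((idealsLE N).filter (· ≠ ⊥)) (fun I => Ideal.absNorm I ≤ N / 2)]
    congr 1
    · apply sum_congr _ (fun _ _ => rfl)
      ext I
      simp only [mem_filter, mem_idealsLE]
      constructor
      · rintro ⟨⟨-, h0⟩, hle⟩; exact ⟨hle, h0⟩
      · rintro ⟨hle, h0⟩; exact ⟨⟨hle.trans (Nat.div_le_self _ _), h0⟩, hle⟩
    · apply sum_congr _ (fun _ _ => rfl)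
      ext I
      simp only [mem_filter, not_le]
  have hS1 : S 1 ≤ 1 := by
    simp only [hS]
    have hsub : (idealsLE 1).filter (· ≠ (⊥ : Ideal (𝓞 K))) ⊆ {⊤} := by
      intro I hI
      rw [mem_filter, mem_idealsLE] at hI
      rw [mem_singleton]
      have h1 : Ideal.absNorm I = 1 := by
        have h0 : Ideal.absNorm I ≠ 0 := by rw [Ne, Ideal.absNorm_eq_zero_iff]; exact hI.2
        omega
      exact Ideal.absNorm_eq_one_iff.mp h1
    calc ∑ I ∈ (idealsLE 1).filter (· ≠ ⊥), (idealDivisorCount I : ℝ) ^ c / Ideal.absNorm I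
        ≤ ∑ I ∈ ({⊤} : Finset (Ideal (𝓞 K))), (idealDivisorCount I : ℝ) ^ c / Ideal.absNorm I :=
          sum_le_sum_of_subset_of_nonneg hsub fun I _ _ => by positivity
      _ = 1 := by rw [sum_singleton, idealDivisorCount_top, Ideal.absNorm_top]; simp
  have hS0 : S 0 = 0 := by
    simp only [hS]
    refine sum_eq_zero fun I hI => ?_
    rw [mem_filter, mem_idealsLE] at hI
    exfalso
    have : Ideal.absNorm I = 0 := by omega
    exact hI.2 (Ideal.absNorm_eq_zero_iff.mp this)
  -- the block bound `B(N) = 2 C₀ (log N)^e`, monotone in `N ≥ 1`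
  have hblock : ∀ N : ℕ, 2 ≤ N →
      ∑ I ∈ ((idealsLE N).filter (· ≠ ⊥)).filter (fun I => N / 2 < Ideal.absNorm I),
        (idealDivisorCount I : ℝ) ^ c / Ideal.absNorm I ≤ 2 * C₀ * Real.log N ^ e := by
    intro N hN
    have hN0 : 0 < N := by omega
    have hN' : (0 : ℝ) < N := by exact_mod_cast hN0
    refine (sum_top_block_le c hN0).trans ?_
    calc 2 / (N : ℝ) * ∑ I ∈ (idealsLE N).filter (· ≠ ⊥), (idealDivisorCount I : ℝ) ^ c
        ≤ 2 / (N : ℝ) * (C₀ * N * Real.log N ^ e) :=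
          mul_le_mul_of_nonneg_left (h42 N hN) (by positivity)
      _ = 2 * C₀ * Real.log N ^ e := by field_simp
  -- strong induction
  have hind : ∀ N : ℕ, 1 ≤ N → S N ≤ 1 + (Nat.log 2 N + 1) * (2 * C₀ * Real.log N ^ e) := by
    intro N
    induction N using Nat.strong_induction_on with
    | _ N ih =>
      intro hN1
      rcases lt_or_ge N 2 with hlt | hge
      · have hN : N = 1 := by omega
        subst hN
        have : (0 : ℝ) ≤ (Nat.log 2 1 + 1) * (2 * C₀ * Real.log (1 : ℕ) ^ e) := by
          positivity
        linarith [hS1]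
      · have hN0 : 0 < N := by omega
        rw [hSsplit N hN0]
        have hhalf1 : 1 ≤ N / 2 := by omega
        have hhalf_lt : N / 2 < N := Nat.div_lt_self hN0 one_lt_two
        have ih' := ih (N / 2) hhalf_lt hhalf1
        have hlog2 : Nat.log 2 (N / 2) + 1 = Nat.log 2 N := by
          rw [Nat.log_div_base]; exact Nat.sub_add_cancel (Nat.log_pos one_lt_two hge)
        -- monotonicity of `log`
        have hlogmono : Real.log ((N / 2 : ℕ) : ℝ) ≤ Real.log N := by
          refine Real.log_le_log (by exact_mod_cast (show 0 < N / 2 by omega)) ?_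
          exact_mod_cast hhalf_lt.le
        have hlog0 : 0 ≤ Real.log ((N / 2 : ℕ) : ℝ) :=
          Real.log_nonneg (by exact_mod_cast hhalf1)
        have hpow : Real.log ((N / 2 : ℕ) : ℝ) ^ e ≤ Real.log N ^ e :=
          pow_le_pow_left₀ hlog0 hlogmono e
        have hB := hblock N hge
        have hcoef : (0 : ℝ) ≤ (Nat.log 2 (N / 2) + 1 : ℝ) := by positivity
        calc S (N / 2) + _ ≤ (1 + (Nat.log 2 (N / 2) + 1) * (2 * C₀ * Real.log ((N / 2 : ℕ) : ℝ) ^ e)) +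
              2 * C₀ * Real.log N ^ e := add_le_add ih' hB
          _ ≤ (1 + (Nat.log 2 (N / 2) + 1) * (2 * C₀ * Real.log N ^ e)) + 2 * C₀ * Real.log N ^ e := by
              gcongr
          _ = 1 + ((Nat.log 2 (N / 2) + 1 : ℕ) + 1 : ℝ) * (2 * C₀ * Real.log N ^ e) := by
              push_cast; ring
          _ = 1 + (Nat.log 2 N + 1) * (2 * C₀ * Real.log N ^ e) := by rw [hlog2]
  -- final constant: for `N ≥ 2`, `log N ≥ 1/2`, `Nat.log 2 N + 1 ≤ 4 log N`, `1 ≤ (2 log N)^{e+1}`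
  refine ⟨2 ^ (e + 1) + 8 * C₀, by positivity, fun N hN => ?_⟩
  have hN' : (2 : ℝ) ≤ N := by exact_mod_cast hN
  have hlog : 1 / 2 ≤ Real.log N := by
    have h2 : (1 : ℝ) / 2 ≤ Real.log 2 := by
      have := Real.log_two_gt_d9; linarith
    exact h2.trans (Real.log_le_log (by norm_num) hN')
  have hlog0 : 0 ≤ Real.log N := by linarith
  have hmain := hind N (by omega)
  -- `Nat.log 2 N ≤ log N / log 2 ≤ 2 log N`
  have hnatlog : (Nat.log 2 N : ℝ) ≤ 2 * Real.log N := by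
    have h1 : (2 : ℝ) ^ (Nat.log 2 N) ≤ N := by exact_mod_cast Nat.pow_log_le_self 2 (by omega)
    have h2 : (Nat.log 2 N : ℝ) * Real.log 2 ≤ Real.log N := by
      rw [← Real.log_pow]; exact Real.log_le_log (by positivity) h1
    have h3 : (1 : ℝ) / 2 ≤ Real.log 2 := by have := Real.log_two_gt_d9; linarith
    have h4 : (0 : ℝ) ≤ Nat.log 2 N := by positivity
    nlinarith
  have hA : (Nat.log 2 N + 1 : ℝ) ≤ 4 * Real.log N := by linarith
  have h1 : (1 : ℝ) ≤ (2 * Real.log N) ^ (e + 1) := one_le_pow₀ (by linarith)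
  calc S N ≤ 1 + (Nat.log 2 N + 1) * (2 * C₀ * Real.log N ^ e) := hmain
    _ ≤ (2 * Real.log N) ^ (e + 1) + (4 * Real.log N) * (2 * C₀ * Real.log N ^ e) := by
        gcongr
    _ = (2 ^ (e + 1) + 8 * C₀) * Real.log N ^ (e + 1) := by ring

/-! ### Lemma 4.5 -/

/-- `τ(0) = 1` with the tree's convention (`idealsLE 0 = {0}`). [folklore] -/
theorem idealDivisorCount_bot : idealDivisorCount (⊥ : Ideal (𝓞 K)) = 1 := by
  classical
  unfold idealDivisorCount
  rw [card_eq_one]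
  refine ⟨⊥, ?_⟩
  ext D
  simp only [mem_filter, mem_idealsLE, mem_singleton, Ideal.absNorm_bot, nonpos_iff_eq_zero,
    Ideal.absNorm_eq_zero_iff]
  exact ⟨fun h => h.1, fun h => ⟨h, h ▸ dvd_rfl⟩⟩

open scoped Classical in
/-- At most one lattice point has `β = 0` (`coordElt` is injective). [folklore] -/
theorem card_filter_coordElt_eq_zero_le_one (s : Finset (ℤ × ℤ × ℤ)) :
    #(s.filter (fun v => coordElt v = 0)) ≤ 1 := by
  classical
  rw [card_le_one]
  intro v hv w hw
  rw [mem_filter] at hv hw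
  exact coordElt_injective (hv.2.trans hw.2.symm)

open scoped Classical in
/-- **Heath-Brown's Lemma 4.5** (p. 23): "Let `𝒞 = (a₁, a₁ + S₀] × (a₂, a₂ + S₀] × (a₃, a₃ + S₀]` be a
cube of side `S₀`, and suppose that `max |a_i| ≤ S₀^A` for some positive constant `A`. … Then there is a
constant `c(A)` such that `∑_{β̂ ∈ 𝒞} τ(β)² ≪ S₀³ (log S₀)^{c(A)}`."  Here for the lattice points
`latticeCube a S₀` of the cube, `β = coordElt β̂`, `τ(β) = idealDivisorCount ((β))`, `A ≥ 1` an integer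
(any real `A > 0` is covered by `⌈A⌉`), `S₀ ≥ 2`, with `c(A) = 2^{4(12A+62)+4} + 1` (Lemma 4.4 with
`n = 3A + 16`, since `N((β)) ≤ 64·(9S₀^A)³ ≤ S₀^{3A+16}`; the lattice count
`#{β̂ ∈ 𝒞 : I ∣ β} ≤ 8S₀³/N(I)`; and the harmonic form of Lemma 4.2). [cite: HeathBrownActa2001, Lemma 4.5] -/
theorem HeathBrown2001_lemma_4_5 {A : ℕ} (hA : 1 ≤ A) :
    ∃ C : ℝ, 0 < C ∧ ∀ (a : ℝ × ℝ × ℝ) (S₀ : ℝ), 2 ≤ S₀ →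
      |a.1| ≤ S₀ ^ A → |a.2.1| ≤ S₀ ^ A → |a.2.2| ≤ S₀ ^ A →
        ∑ v ∈ latticeCube a S₀, (idealDivisorCount (Ideal.span {coordElt v}) : ℝ) ^ 2 ≤
          C * S₀ ^ 3 * Real.log S₀ ^ (2 ^ (4 * (12 * A + 62) + 4) + 1) := by
  classical
  obtain ⟨n, hn⟩ : ∃ n : ℕ, n = 3 * A + 16 := ⟨_, rfl⟩
  have hn1 : 1 ≤ n := by omega
  obtain ⟨c, hc⟩ : ∃ c : ℕ, c = 12 * A + 62 := ⟨_, rfl⟩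
  have hcn : c = 2 * (2 * n - 1) := by omega
  obtain ⟨C₁, hC₁, hharm⟩ := exists_sum_idealDivisorCount_pow_div_le c
  rw [← hc]
  set e : ℕ := 2 ^ (4 * c + 4) + 1 with he
  refine ⟨(1 / Real.log 2) ^ e + 4 ^ (n - 1) * (8 * C₁), by positivity, ?_⟩
  intro a S₀ hS₀ ha1 ha2 ha3
  have hS1 : 1 ≤ S₀ := by linarith
  have hS0 : 0 < S₀ := by linarith
  have hlog2 : 0 < Real.log 2 := Real.log_pos one_lt_two
  have hlogS : Real.log 2 ≤ Real.log S₀ := Real.log_le_log two_pos hS₀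
  have hlogS0 : 0 < Real.log S₀ := lt_of_lt_of_le hlog2 hlogS
  set N : ℕ := ⌊S₀⌋₊ with hN
  have hN2 : 2 ≤ N := Nat.le_floor (by exact_mod_cast hS₀)
  have hNS : (N : ℝ) ≤ S₀ := Nat.floor_le hS0.le
  set T := (idealsLE N).filter (· ≠ (⊥ : Ideal (𝓞 K))) with hT
  set Cube := latticeCube a S₀ with hCube
  -- coordinates in the cube are `≤ 3 S₀^A` in modulus
  have hSA : S₀ ≤ S₀ ^ A := by
    calc S₀ = S₀ ^ 1 := (pow_one _).symm
      _ ≤ S₀ ^ A := pow_le_pow_right₀ hS1 hA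
  have hcoord : ∀ v ∈ Cube, |(v.1 : ℝ)| + |(v.2.1 : ℝ)| + |(v.2.2 : ℝ)| ≤ 9 * S₀ ^ A := by
    intro v hv
    rw [hCube, latticeCube, mem_product, mem_product, mem_Ioc, mem_Ioc, mem_Ioc] at hv
    obtain ⟨⟨h1, h1'⟩, ⟨h2, h2'⟩, ⟨h3, h3'⟩⟩ := hv
    have side : ∀ (t : ℝ) (x : ℤ), ⌊t⌋ < x → x ≤ ⌊t + S₀⌋ → |t| ≤ S₀ ^ A →
        |(x : ℝ)| ≤ 3 * S₀ ^ A := by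
      intro t x hx hx' ht
      have e1 : (⌊t⌋ : ℝ) < x := by exact_mod_cast hx
      have e2 : (x : ℝ) ≤ ⌊t + S₀⌋ := by exact_mod_cast hx'
      have e3 : t < ⌊t⌋ + 1 := Int.lt_floor_add_one t
      have e4 : (⌊t + S₀⌋ : ℝ) ≤ t + S₀ := Int.floor_le _
      rw [abs_le] at ht ⊢
      constructor <;> linarith
    have b1 := side a.1 v.1 h1 h1' ha1
    have b2 := side a.2.1 v.2.1 h2 h2' ha2
    have b3 := side a.2.2 v.2.2 h3 h3' ha3
    linarith
  -- `N((β)) ≤ S₀^n`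
  have hnorm : ∀ v ∈ Cube, (Ideal.absNorm (Ideal.span {coordElt v}) : ℝ) ≤ S₀ ^ n := by
    intro v hv
    have h216 : (46656 : ℝ) ≤ S₀ ^ 16 := by
      calc (46656 : ℝ) ≤ 2 ^ 16 := by norm_num
        _ ≤ S₀ ^ 16 := pow_le_pow_left₀ (by norm_num) hS₀ 16
    calc (Ideal.absNorm (Ideal.span {coordElt v}) : ℝ)
        ≤ 64 * (|(v.1 : ℝ)| + |(v.2.1 : ℝ)| + |(v.2.2 : ℝ)|) ^ 3 := absNorm_span_coordElt_le v
      _ ≤ 64 * (9 * S₀ ^ A) ^ 3 := by gcongr; exact hcoord v hv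
      _ = 46656 * (S₀ ^ A) ^ 3 := by ring
      _ ≤ S₀ ^ 16 * (S₀ ^ A) ^ 3 := by gcongr
      _ = S₀ ^ n := by rw [hn]; ring
  -- Step 1: pointwise, `τ((β))² ≤ [β = 0] + 4^{n-1} ∑_{I ∈ T, β ∈ I} τ(I)^c`
  have hpt : ∀ v ∈ Cube, (idealDivisorCount (Ideal.span {coordElt v}) : ℝ) ^ 2 ≤
      (if coordElt v = 0 then (1 : ℝ) else 0) +
        4 ^ (n - 1) * ∑ I ∈ T.filter (fun I => coordElt v ∈ I), (idealDivisorCount I : ℝ) ^ c := by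
    intro v hv
    have hsum0 : 0 ≤ ∑ I ∈ T.filter (fun I => coordElt v ∈ I), (idealDivisorCount I : ℝ) ^ c :=
      sum_nonneg fun I _ => by positivity
    by_cases h0 : coordElt v = 0
    · rw [if_pos h0]
      have hτ1 : idealDivisorCount (Ideal.span {coordElt v}) = 1 := by
        rw [h0, Ideal.span_singleton_zero, idealDivisorCount_bot]
      rw [hτ1, Nat.cast_one, one_pow]
      have h4 : (0 : ℝ) ≤ 4 ^ (n - 1) *
          ∑ I ∈ T.filter (fun I => coordElt v ∈ I), (idealDivisorCount I : ℝ) ^ c :=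
        mul_nonneg (pow_nonneg (by norm_num) _) hsum0
      linarith
    · rw [if_neg h0, zero_add]
      have hI0 : Ideal.span {coordElt v} ≠ ⊥ := by
        rwa [Ne, Ideal.span_singleton_eq_bot]
      obtain ⟨J, hJdvd, hJnorm, hτ⟩ := HeathBrown2001_lemma_4_4 hn1 hI0
      have hJ0 : J ≠ ⊥ := by
        rintro rfl; exact hI0 (zero_dvd_iff.mp hJdvd)
      -- `N(J) ≤ N((β))^{1/n} ≤ S₀`, so `N(J) ≤ N`
      have hJS : (Ideal.absNorm J : ℝ) ≤ S₀ := by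
        refine hJnorm.trans ?_
        calc (Ideal.absNorm (Ideal.span {coordElt v}) : ℝ) ^ ((n : ℝ)⁻¹)
            ≤ (S₀ ^ n) ^ ((n : ℝ)⁻¹) :=
              Real.rpow_le_rpow (by positivity) (hnorm v hv) (by positivity)
          _ = S₀ := by
              rw [← Real.rpow_natCast, ← Real.rpow_mul hS0.le, mul_inv_cancel₀ (by positivity),
                Real.rpow_one]
      have hJN : Ideal.absNorm J ≤ N := Nat.le_floor hJS
      have hJT : J ∈ T.filter (fun I => coordElt v ∈ I) := by
        rw [mem_filter, hT, mem_filter, mem_idealsLE]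
        exact ⟨⟨hJN, hJ0⟩, Ideal.dvd_span_singleton.mp hJdvd⟩
      have hτR : (idealDivisorCount (Ideal.span {coordElt v}) : ℝ) ≤
          2 ^ (n - 1) * (idealDivisorCount J : ℝ) ^ (2 * n - 1) := by exact_mod_cast hτ
      calc (idealDivisorCount (Ideal.span {coordElt v}) : ℝ) ^ 2
          ≤ (2 ^ (n - 1) * (idealDivisorCount J : ℝ) ^ (2 * n - 1)) ^ 2 :=
            pow_le_pow_left₀ (by positivity) hτR 2
        _ = 4 ^ (n - 1) * (idealDivisorCount J : ℝ) ^ c := by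
            rw [hcn, mul_pow, show (4 : ℝ) ^ (n - 1) = 2 ^ (2 * (n - 1)) by rw [pow_mul]; norm_num]
            ring
        _ ≤ 4 ^ (n - 1) * ∑ I ∈ T.filter (fun I => coordElt v ∈ I), (idealDivisorCount I : ℝ) ^ c := by
            refine mul_le_mul_of_nonneg_left ?_ (by positivity)
            exact single_le_sum (f := fun I => (idealDivisorCount I : ℝ) ^ c)
              (fun I _ => by positivity) hJT
  -- Step 2: sum over the cube and swap
  have hswap : ∑ v ∈ Cube, ∑ I ∈ T.filter (fun I => coordElt v ∈ I), (idealDivisorCount I : ℝ) ^ c =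
      ∑ I ∈ T, (idealDivisorCount I : ℝ) ^ c * #(Cube.filter (fun v => coordElt v ∈ I)) := by
    simp only [sum_filter]
    rw [sum_comm]
    refine sum_congr rfl fun I _ => ?_
    rw [← sum_filter, sum_const, nsmul_eq_mul, mul_comm]
  -- Step 3: the lattice count for `I ∈ T`
  have hcount : ∀ I ∈ T, (#(Cube.filter (fun v => coordElt v ∈ I)) : ℝ) ≤
      8 * S₀ ^ 3 / Ideal.absNorm I := by
    intro I hI
    rw [hT, mem_filter, mem_idealsLE] at hI
    have hIS : (Ideal.absNorm I : ℝ) ≤ S₀ := le_trans (by exact_mod_cast hI.1) hNS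
    exact card_latticeCube_filter_mem_le' hI.2 a hIS
  have hlogN : Real.log N ^ e ≤ Real.log S₀ ^ e := by
    have hN1 : (1 : ℝ) ≤ N := by exact_mod_cast (show 1 ≤ N by omega)
    exact pow_le_pow_left₀ (Real.log_nonneg hN1)
      (Real.log_le_log (by linarith) hNS) e
  -- assemble
  calc ∑ v ∈ Cube, (idealDivisorCount (Ideal.span {coordElt v}) : ℝ) ^ 2
      ≤ ∑ v ∈ Cube, ((if coordElt v = 0 then (1 : ℝ) else 0) +
          4 ^ (n - 1) * ∑ I ∈ T.filter (fun I => coordElt v ∈ I), (idealDivisorCount I : ℝ) ^ c) :=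
        sum_le_sum hpt
    _ = #(Cube.filter (fun v => coordElt v = 0)) +
          4 ^ (n - 1) * ∑ I ∈ T, (idealDivisorCount I : ℝ) ^ c *
            #(Cube.filter (fun v => coordElt v ∈ I)) := by
        rw [sum_add_distrib, ← mul_sum, hswap, ← sum_filter, sum_const, nsmul_eq_mul, mul_one]
    _ ≤ 1 + 4 ^ (n - 1) * ∑ I ∈ T, (idealDivisorCount I : ℝ) ^ c * (8 * S₀ ^ 3 / Ideal.absNorm I) := by
        gcongr with I hI
        · exact_mod_cast card_filter_coordElt_eq_zero_le_one Cube
        · exact hcount I hI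
    _ = 1 + 4 ^ (n - 1) * (8 * S₀ ^ 3) *
          ∑ I ∈ T, (idealDivisorCount I : ℝ) ^ c / Ideal.absNorm I := by
        conv_rhs => rw [mul_assoc, mul_sum]
        congr 1; congr 1
        exact sum_congr rfl fun I _ => by ring
    _ ≤ 1 + 4 ^ (n - 1) * (8 * S₀ ^ 3) * (C₁ * Real.log N ^ e) := by
        gcongr
        exact hharm N hN2
    _ ≤ (1 / Real.log 2) ^ e * S₀ ^ 3 * Real.log S₀ ^ e +
          4 ^ (n - 1) * (8 * S₀ ^ 3) * (C₁ * Real.log S₀ ^ e) := by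
        gcongr
        -- `1 ≤ (log S₀/log 2)^e · S₀³`
        have h1 : (1 : ℝ) ≤ (1 / Real.log 2) ^ e * Real.log S₀ ^ e := by
          rw [← mul_pow]
          refine one_le_pow₀ ?_
          rw [one_div, inv_mul_eq_div, le_div_iff₀ hlog2, one_mul]
          exact hlogS
        have h3 : (1 : ℝ) ≤ S₀ ^ 3 := one_le_pow₀ hS1
        calc (1 : ℝ) ≤ (1 / Real.log 2) ^ e * Real.log S₀ ^ e := h1
          _ ≤ (1 / Real.log 2) ^ e * Real.log S₀ ^ e * S₀ ^ 3 :=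
              le_mul_of_one_le_right (by positivity) h3
          _ = (1 / Real.log 2) ^ e * S₀ ^ 3 * Real.log S₀ ^ e := by ring
    _ = ((1 / Real.log 2) ^ e + 4 ^ (n - 1) * (8 * C₁)) * S₀ ^ 3 * Real.log S₀ ^ e := by ring

end Literature.NumberTheory.Sieve.CubicSieve

end
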